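import Mathlib.RingTheory.Valuation.ValuationSubring
import Mathlib.RingTheory.Valuation.LocalSubring
import Mathlib.RingTheory.KrullDimension.LocalRing
import Mathlib.RingTheory.IntegralClosure.IsIntegralClosure.Basic
import Mathlib.RingTheory.Algebraic.Integral
import Mathlib.Algebra.Polynomial.Lifts
import Mathlib.FieldTheory.Minpoly.IsIntegrallyClosed
import HarnessLib

/-!
# Height-one valued fields: the `π`-adic toolkit for Temkin's decompletion lemma

Topic: `Literature/AlgebraicGeometry/Resolution`. Elementary consequences of "`k` is a valued
field of height one" (M. Temkin, *Inseparable local uniformization*, J. Algebra 373 (2013)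
65–119 = arXiv:0804.1554v3, §3, p. 31: "Throughout §3, `k` is a valued field of height `1`",
and the proof of Lemma 3.3.2: "complete it and invert a non-zero `π ∈ k°°`", "Multiplying `f`
and `π` by a large power of `π` we achieve that `f ⊂ 𝒜° = Â`"), in the affine rendering of the
tree (`Temkin2013_Lemma332_nft`: `Ok : ValuationSubring k` with `ringKrullDim Ok = 1`), used
throughout the algebraic proof of that lemma:

* `exists_pow_eq_mul_of_ringKrullDim_eq_one` — in a valuation ring of Krull dimension one, a
  non-unit `π` has a power divisible by any given non-zero `b` (`πⁿ = b·c`).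
* `exists_pow_mul_mem_of_ringKrullDim_eq_one` — `k = k°[1/π]`: for every `z ∈ k` some `πᴺ z`
  lies in `k°`.
* `exists_pow_eq_mul_of_algebraic` — for a valuation ring `O` of an ALGEBRAIC extension `m/k`
  with `O ∩ k = k°`: every non-zero `o ∈ O` divides some power of `π` in `O`.
* `exists_pow_mul_isIntegral` — every `z ∈ m` becomes integral over (the image of) `k°` after
  multiplication by a power of `π`.
* `minpoly_mem_of_isIntegral` — the minimal polynomial over `k` of an element integral over
  `k°` has coefficients in `k°` (valuation rings are integrally closed).

All PROVED, [folklore].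

## Sources

* M. Temkin, arXiv:0804.1554v3, §3 (p. 31) and the proof of Lemma 3.3.2 (pp. 45–46).
-/

noncomputable section

namespace Literature.AlgebraicGeometry.Resolution

universe u

open IsLocalRing

section HeightOne

variable {k : Type u} [Field k] (V : ValuationSubring k)

/-- In a valuation ring of Krull dimension one, every element of the maximal ideal has a power
divisible by any given non-zero element: `πⁿ = b·c`. [folklore] -/
theorem exists_pow_eq_mul_of_ringKrullDim_eq_one (hdim : ringKrullDim V = 1) {π b : V}
    (hπ : π ∈ maximalIdeal V) (hb : b ≠ 0) : ∃ (n : ℕ) (c : V), π ^ n = b * c := by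
  have h := ((ringKrullDim_eq_one_iff_of_isLocalRing_isDomain).mp hdim).2 b hb hπ
  obtain ⟨n, hn⟩ := h
  obtain ⟨c, hc⟩ := Ideal.mem_span_singleton'.mp hn
  exact ⟨n, c, by rw [← hc, mul_comm]⟩

/-- `k = k°[1/π]` for a height-one valuation ring `k°` and a non-zero non-unit `π`: every
`z ∈ k` satisfies `πᴺ z ∈ k°` for some `N`. [folklore] -/
theorem exists_pow_mul_mem_of_ringKrullDim_eq_one (hdim : ringKrullDim V = 1) {π : k}
    (hπV : π ∈ V) (hπ : V.valuation π < 1) (z : k) : ∃ N : ℕ, π ^ N * z ∈ V := by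
  by_cases hz : z ∈ V
  · exact ⟨0, by simpa using hz⟩
  have hz0 : z ≠ 0 := by rintro rfl; exact hz V.zero_mem
  have hzi : z⁻¹ ∈ V := (V.mem_or_inv_mem z).resolve_left hz
  have hb : (⟨z⁻¹, hzi⟩ : V) ≠ 0 := by
    intro h; apply hz0; simpa using congrArg ((↑) : V → k) h
  have hπ' : (⟨π, hπV⟩ : V) ∈ maximalIdeal V := (V.valuation_lt_one_iff ⟨π, hπV⟩).mpr hπ
  obtain ⟨n, c, hc⟩ := exists_pow_eq_mul_of_ringKrullDim_eq_one V hdim hπ' hb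
  refine ⟨n, ?_⟩
  have hck : (π : k) ^ n = z⁻¹ * c := by simpa using congrArg ((↑) : V → k) hc
  have : π ^ n * z = c := by
    rw [hck, mul_comm z⁻¹, mul_assoc, inv_mul_cancel₀ hz0, mul_one]
  rw [this]; exact c.2

/-- A non-zero element of `k°` divides a power of `π`. [folklore] -/
theorem exists_pow_eq_mul_of_mem (hdim : ringKrullDim V = 1) {π : k} (hπV : π ∈ V)
    (hπ : V.valuation π < 1) {b : k} (hbV : b ∈ V) (hb : b ≠ 0) :
    ∃ (n : ℕ) (c : k), c ∈ V ∧ π ^ n = b * c := by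
  have hb' : (⟨b, hbV⟩ : V) ≠ 0 := by
    intro h; apply hb; simpa using congrArg ((↑) : V → k) h
  have hπ' : (⟨π, hπV⟩ : V) ∈ maximalIdeal V := (V.valuation_lt_one_iff ⟨π, hπV⟩).mpr hπ
  obtain ⟨n, c, hc⟩ := exists_pow_eq_mul_of_ringKrullDim_eq_one V hdim hπ' hb'
  exact ⟨n, c, c.2, by simpa using congrArg ((↑) : V → k) hc⟩

end HeightOne

section Extension

variable {k : Type u} {m : Type u} [Field k] [Field m] [Algebra k m]
  (V : ValuationSubring k)

/-- Integrality over `k°` (as an abstract `k°`-algebra structure on `m` through `k`) implies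
integrality over the image subring `k° ⊆ m`. [folklore] -/
theorem isIntegral_map_of_isIntegral {z : m}
    (hz : @IsIntegral V m _ _ ((algebraMap k m).comp V.subtype).toAlgebra z) :
    IsIntegral (V.toSubring.map (algebraMap k m)) z := by
  letI : Algebra V m := ((algebraMap k m).comp V.subtype).toAlgebra
  obtain ⟨p, hp, hpz⟩ := hz
  set V' := V.toSubring.map (algebraMap k m)
  let e : V →+* V' := ((algebraMap k m).comp V.subtype).codRestrict V'
    fun c => ⟨c, c.2, rfl⟩
  refine ⟨p.map e, hp.map e, ?_⟩
  rw [Polynomial.eval₂_map]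
  exact hpz

/-- Every element of an ALGEBRAIC extension `m/k` becomes integral over (the image of) `k°`
after multiplication by a power of `π`, for `k°` of height one and `π` a non-zero non-unit
("multiplying by a large power of `π`", Temkin, proof of Lemma 3.3.2). [folklore] -/
theorem exists_pow_mul_isIntegral [Algebra.IsAlgebraic k m] (hdim : ringKrullDim V = 1) {π : k}
    (hπV : π ∈ V) (hπ : V.valuation π < 1) (z : m) :
    ∃ N : ℕ, IsIntegral (V.toSubring.map (algebraMap k m)) (algebraMap k m π ^ N * z) := by
  letI : Algebra V m := ((algebraMap k m).comp V.subtype).toAlgebra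
  haveI : IsScalarTower V k m := IsScalarTower.of_algebraMap_eq fun _ => rfl
  haveI : Algebra.IsAlgebraic V k := IsLocalization.isAlgebraic k (nonZeroDivisors V)
  haveI : Algebra.IsAlgebraic V m := Algebra.IsAlgebraic.trans V k m
  obtain ⟨y, hy0, hy⟩ :=
    IsAlgebraic.exists_integral_multiple (Algebra.IsAlgebraic.isAlgebraic (R := V) z)
  have hy0' : (y : k) ≠ 0 := fun h => hy0 (Subtype.ext h)
  obtain ⟨n, c, hcV, hc⟩ := exists_pow_eq_mul_of_mem V hdim hπV hπ y.2 hy0'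
  refine ⟨n, isIntegral_map_of_isIntegral V ?_⟩
  have : algebraMap k m π ^ n * z = (⟨c, hcV⟩ : V) • (y • z) := by
    rw [Algebra.smul_def, Algebra.smul_def, ← mul_assoc, ← map_mul, ← map_pow, hc]
    change algebraMap k m (↑y * c) * z = algebraMap k m ((⟨c, hcV⟩ * y : V) : k) * z
    congr 2
    push_cast
    ring
  rw [this]
  exact (hy.smul _)

variable (O : ValuationSubring m)

/-- If `O ∩ k = k°` then `k°` maps into `O`. [folklore] -/
theorem algebraMap_mem_of_comap_eq' (hO : O.comap (algebraMap k m) = V) {c : k} (hc : c ∈ V) :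
    algebraMap k m c ∈ O := by
  rw [← hO] at hc; exact hc

/-- Elements integral over (the image of) `k°` lie in every valuation ring over `k°`
(valuation rings are integrally closed). [folklore] -/
theorem mem_of_isIntegral_map (hO : O.comap (algebraMap k m) = V) {z : m}
    (hz : IsIntegral (V.toSubring.map (algebraMap k m)) z) : z ∈ O := by
  have hle : V.toSubring.map (algebraMap k m) ≤ O.toSubring := by
    rintro _ ⟨c, hc, rfl⟩; exact algebraMap_mem_of_comap_eq' V O hO hc
  letI : Algebra (V.toSubring.map (algebraMap k m)) O := (Subring.inclusion hle).toAlgebra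
  haveI : IsScalarTower (V.toSubring.map (algebraMap k m)) O m :=
    IsScalarTower.of_algebraMap_eq (fun _ => rfl)
  obtain ⟨y, rfl⟩ := IsIntegrallyClosed.algebraMap_eq_of_integral (R := O) hz.tower_top
  exact y.2

/-- For a valuation ring `O` of an algebraic extension `m/k` with `O ∩ k = k°`, `k°` of height
one: every non-zero `o ∈ m` (in particular every non-zero element of `O`) divides a power of
`π` in `O`. [folklore] -/
theorem exists_pow_eq_mul_of_algebraic [Algebra.IsAlgebraic k m] (hdim : ringKrullDim V = 1)
    {π : k} (hπV : π ∈ V) (hπ : V.valuation π < 1) (hO : O.comap (algebraMap k m) = V)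
    {o : m} (ho0 : o ≠ 0) :
    ∃ (N : ℕ) (o' : m), o' ∈ O ∧ algebraMap k m π ^ N = o * o' := by
  -- `π^M o⁻¹` is integral over `k°` for some `M`, hence lies in `O`
  obtain ⟨M, hM⟩ := exists_pow_mul_isIntegral V hdim hπV hπ o⁻¹
  refine ⟨M, algebraMap k m π ^ M * o⁻¹, mem_of_isIntegral_map V O hO hM, ?_⟩
  rw [mul_comm o, mul_assoc, inv_mul_cancel₀ ho0, mul_one]

/-- The minimal polynomial over `k` of an element integral over (the image of) `k°` has all
its coefficients in `k°` (`k°` is integrally closed with fraction field `k`). [folklore] -/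
theorem coeff_minpoly_mem_of_isIntegral {z : m}
    (hz : IsIntegral (V.toSubring.map (algebraMap k m)) z) (i : ℕ) :
    (minpoly k z).coeff i ∈ V := by
  letI : Algebra V m := ((algebraMap k m).comp V.subtype).toAlgebra
  haveI : IsScalarTower V k m := IsScalarTower.of_algebraMap_eq fun _ => rfl
  -- transfer integrality to the abstract `k°`-structure: lift the monic equation coefficientwise
  have hz' : IsIntegral V z := by
    let V' := V.toSubring.map (algebraMap k m)
    obtain ⟨p, hp, hpz⟩ := hz
    let fV : V →+* m := (algebraMap k m).comp V.subtype
    let P : Polynomial m := p.map (algebraMap V' m)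
    have hPmonic : P.Monic := hp.map (algebraMap V' m)
    have hPz : P.eval₂ (RingHom.id m) z = 0 := by
      change (p.map (algebraMap V' m)).eval₂ (RingHom.id m) z = 0
      rw [Polynomial.eval₂_map, RingHom.id_comp]; exact hpz
    have hlifts : P ∈ Polynomial.lifts fV := by
      rw [Polynomial.lifts_iff_coeff_lifts]
      intro i
      rw [Polynomial.coeff_map]
      obtain ⟨c, hc, hc'⟩ := (p.coeff i).2
      exact ⟨⟨c, hc⟩, hc'⟩
    obtain ⟨q, hqP, -, hqmonic⟩ := Polynomial.lifts_and_degree_eq_and_monic hlifts hPmonic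
    refine ⟨q, hqmonic, ?_⟩
    change q.eval₂ fV z = 0
    rw [← hPz, ← hqP, Polynomial.eval₂_map, RingHom.id_comp]
  rw [minpoly.isIntegrallyClosed_eq_field_fractions' k hz', Polynomial.coeff_map]
  exact ((minpoly V z).coeff i).2

end Extension

end Literature.AlgebraicGeometry.Resolution
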